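import Summits.Ventures.PercRepro.C025ProfilePLDBridgeTruncate
import Summits.Ventures.PercRepro.C025ProfileParallelClasses
import Summits.Ventures.PercRepro.C025ProfilePLDClosureUnion

/-!
# PER-LAYER DOMINANCE IS PRESERVED BY ADDING PARALLEL CLASSES: C-025 ON EVERY TRUNCATION OF
«(PLD)-MATROID ⊕ PARALLEL CLASSES ⊕ FREE POINTS» (night-3 g29)

`proofs/NIGHT3-G29-PARALLEL.md` §4.  For a finite matroid `M` satisfying PER-LAYER DOMINANCE and a parallel-classes
matroid `(freeOn univ).comapOn ↑E₂ c` (any classes, any sizes; `C025ProfileParallelClasses`), the direct sum satisfies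
(PLD) again (`pld_disjointSum_parallelClasses`: the rank of `I` in the sum is `ρ_M(I ∩ E_M) + #classes met by I ∩ E₂`,
`toNat_eRk_disjointSum_comapOn`, and `PLDClosure.pld_union_classes` does the rest), hence — by the landed bridge
`PLDBridge.rls_disjointSum_freeOn_of_pld` — C-025 holds at every `(p, q)` on every truncation of
`M ⊕ (parallel classes) ⊕ (free points)` (`rls_truncate_disjointSum_parallelClasses_freeOn_of_pld`).  With g28's
theorems this covers «paving ⊕ parallel classes ⊕ free points», «rank ≤ 2 ⊕ parallel classes ⊕ free points», and
«any matroid ⊕ parallel classes ⊕ free points» at levels below the girth; with `M` empty it is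
`ParallelPLD.pld_of_parallelClasses` again.
No `def`, no `instance`, no notation.  Axioms: standard.
-/

open scoped Matroid

namespace PercRepro

open Finset ThmH

namespace PLDClosure

variable {α β : Type} [DecidableEq α] [DecidableEq β]

/-! ### The matroid theorem and its C-025 corollary -/

omit [DecidableEq α] [DecidableEq β] in
/-- The rank of a finite matroid is never `⊤`. -/
theorem eRk_ne_top' (M : Matroid α) [M.Finite] (X : Set α) : M.eRk X ≠ ⊤ :=
  ne_top_of_le_ne_top (M.eRank_ne_top_iff.2 inferInstance) (M.eRk_le_eRank X)

omit [DecidableEq α] [DecidableEq β] in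
/-- The direct sum with a parallel-classes matroid is finite (a theorem, not an instance). -/
theorem disjointSum_comapOn_finite (M : Matroid α) [M.Finite] (c : α → β) (E₂ : Finset α)
    (h : Disjoint M.E (E₂ : Set α)) :
    (M.disjointSum ((Matroid.freeOn (Set.univ : Set β)).comapOn (E₂ : Set α) c) h).Finite :=
  ⟨by rw [Matroid.disjointSum_ground_eq, Matroid.comapOn_ground_eq]; exact M.ground_finite.union E₂.finite_toSet⟩

omit [DecidableEq β] in
/-- The ground finset of the sum. -/
theorem gr_disjointSum_comapOn (M : Matroid α) [M.Finite] (c : α → β) (E₂ : Finset α)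
    (h : Disjoint M.E (E₂ : Set α)) :
    haveI := disjointSum_comapOn_finite M c E₂ h
    gr (M.disjointSum ((Matroid.freeOn (Set.univ : Set β)).comapOn (E₂ : Set α) c) h) = gr M ∪ E₂ := by
  haveI := disjointSum_comapOn_finite M c E₂ h
  apply Finset.coe_injective
  rw [coe_gr, Matroid.disjointSum_ground_eq, Matroid.comapOn_ground_eq, coe_union, coe_gr]

/-- The rank of `X ⊆ gr M ∪ E₂` in the sum, in `ℕ`: `ρ_M(X ∩ E_M) + #(classes met by X ∩ E₂)`. -/
theorem toNat_eRk_disjointSum_comapOn (M : Matroid α) [M.Finite] (c : α → β) (E₂ : Finset α)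
    (h : Disjoint M.E (E₂ : Set α)) (X : Finset α) :
    ((M.disjointSum ((Matroid.freeOn (Set.univ : Set β)).comapOn (E₂ : Set α) c) h).eRk (X : Set α)).toNat =
      (M.eRk ((X ∩ gr M : Finset α) : Set α)).toNat + ((X ∩ E₂).image c).card := by
  rw [SecondRow.eRk_disjointSum, Matroid.comapOn_ground_eq, ← coe_gr M, ← coe_inter, ← coe_inter,
    ParallelPLD.eRk_comapOn c E₂ (X ∩ E₂) inter_subset_right]
  obtain ⟨a, ha⟩ : ∃ a : ℕ, M.eRk ((X ∩ gr M : Finset α) : Set α) = a :=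
    ⟨_, (ENat.coe_toNat (eRk_ne_top' M _)).symm⟩
  rw [ha, ← Nat.cast_add, ENat.toNat_coe, ENat.toNat_coe]

/-- PER-LAYER DOMINANCE IS PRESERVED BY ADDING PARALLEL CLASSES: if `M` satisfies the hPLD binder of
`PLDBridge.rls_disjointSum_freeOn_of_pld`, so does `M ⊕ (freeOn univ).comapOn ↑E₂ c`. -/
theorem pld_disjointSum_parallelClasses (M : Matroid α) [M.Finite]
    (hPLD : ∀ lo hi δ Θ : ℕ, Θ ≤ lo + hi + δ → (lo = 0 ∨ lo + hi + δ ≤ Θ) →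
      (∑ I ∈ (gr M).powerset, (if lo ≤ (M.eRk (I : Set α)).toNat ∧ (M.eRk (I : Set α)).toNat ≤ hi ∧
          Θ ≤ (M.eRk ((gr M \ I : Finset α) : Set α)).toNat + (M.eRk (I : Set α)).toNat then
          ((M.eRk ((gr M \ I : Finset α) : Set α)).toNat).choose δ else 0)) ≤
        ∑ I ∈ (gr M).powerset, (if lo + δ ≤ (M.eRk ((gr M \ I : Finset α) : Set α)).toNat ∧
          (M.eRk ((gr M \ I : Finset α) : Set α)).toNat ≤ hi + δ then
          ((M.eRk ((gr M \ I : Finset α) : Set α)).toNat).choose δ else 0))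
    (c : α → β) (E₂ : Finset α) (h : Disjoint M.E (E₂ : Set α)) :
    haveI := disjointSum_comapOn_finite M c E₂ h
    ∀ lo hi δ Θ : ℕ, Θ ≤ lo + hi + δ → (lo = 0 ∨ lo + hi + δ ≤ Θ) →
      (∑ I ∈ (gr (M.disjointSum ((Matroid.freeOn (Set.univ : Set β)).comapOn (E₂ : Set α) c) h)).powerset,
        (if lo ≤ ((M.disjointSum ((Matroid.freeOn (Set.univ : Set β)).comapOn (E₂ : Set α) c) h).eRk
              (I : Set α)).toNat ∧
            ((M.disjointSum ((Matroid.freeOn (Set.univ : Set β)).comapOn (E₂ : Set α) c) h).eRk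
              (I : Set α)).toNat ≤ hi ∧
            Θ ≤ ((M.disjointSum ((Matroid.freeOn (Set.univ : Set β)).comapOn (E₂ : Set α) c) h).eRk
              ((gr (M.disjointSum ((Matroid.freeOn (Set.univ : Set β)).comapOn (E₂ : Set α) c) h) \ I :
                Finset α) : Set α)).toNat +
              ((M.disjointSum ((Matroid.freeOn (Set.univ : Set β)).comapOn (E₂ : Set α) c) h).eRk
                (I : Set α)).toNat then
          (((M.disjointSum ((Matroid.freeOn (Set.univ : Set β)).comapOn (E₂ : Set α) c) h).eRk
            ((gr (M.disjointSum ((Matroid.freeOn (Set.univ : Set β)).comapOn (E₂ : Set α) c) h) \ I :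
              Finset α) : Set α)).toNat).choose δ
        else 0)) ≤
      ∑ I ∈ (gr (M.disjointSum ((Matroid.freeOn (Set.univ : Set β)).comapOn (E₂ : Set α) c) h)).powerset,
        (if lo + δ ≤ ((M.disjointSum ((Matroid.freeOn (Set.univ : Set β)).comapOn (E₂ : Set α) c) h).eRk
              ((gr (M.disjointSum ((Matroid.freeOn (Set.univ : Set β)).comapOn (E₂ : Set α) c) h) \ I :
                Finset α) : Set α)).toNat ∧
            ((M.disjointSum ((Matroid.freeOn (Set.univ : Set β)).comapOn (E₂ : Set α) c) h).eRk
              ((gr (M.disjointSum ((Matroid.freeOn (Set.univ : Set β)).comapOn (E₂ : Set α) c) h) \ I :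
                Finset α) : Set α)).toNat ≤ hi + δ then
          (((M.disjointSum ((Matroid.freeOn (Set.univ : Set β)).comapOn (E₂ : Set α) c) h).eRk
            ((gr (M.disjointSum ((Matroid.freeOn (Set.univ : Set β)).comapOn (E₂ : Set α) c) h) \ I :
              Finset α) : Set α)).toNat).choose δ
        else 0) := by
  haveI := disjointSum_comapOn_finite M c E₂ h
  intro lo hi δ Θ hΘ hlo
  have hdisj : Disjoint (gr M) E₂ := by
    rw [← Finset.disjoint_coe, coe_gr]; exact h
  have hfilt : E₂.filter (fun e => c e ∈ E₂.image c) = E₂ :=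
    Finset.filter_true_of_mem fun e he => mem_image_of_mem c he
  have key := pld_union_classes (gr M) (fun I => (M.eRk (I : Set α)).toNat)
    (fun I => (M.eRk ((gr M \ I : Finset α) : Set α)).toNat) hPLD c E₂ hdisj (E₂.image c) lo hi δ Θ hΘ hlo
  rw [hfilt] at key
  rw [gr_disjointSum_comapOn]
  -- rewrite both sides of the goal through the rank formula; `(gr M ∪ E₂) ∖ I` splits as `(gr M ∖ I) ∪ (E₂ ∖ I)`
  have hrk : ∀ I ∈ (gr M ∪ E₂).powerset,
      ((M.disjointSum ((Matroid.freeOn (Set.univ : Set β)).comapOn (E₂ : Set α) c) h).eRk (I : Set α)).toNat =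
        (M.eRk ((I ∩ gr M : Finset α) : Set α)).toNat + ((I ∩ E₂).image c).card :=
    fun I _ => toNat_eRk_disjointSum_comapOn M c E₂ h I
  have hcork : ∀ I ∈ (gr M ∪ E₂).powerset,
      ((M.disjointSum ((Matroid.freeOn (Set.univ : Set β)).comapOn (E₂ : Set α) c) h).eRk
        (((gr M ∪ E₂) \ I : Finset α) : Set α)).toNat =
        (M.eRk ((gr M \ (I ∩ gr M) : Finset α) : Set α)).toNat + ((E₂ \ I).image c).card := by
    intro I _
    have s1 : ((gr M ∪ E₂) \ I) ∩ gr M = gr M \ (I ∩ gr M) := by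
      ext e
      simp only [mem_inter, mem_sdiff, mem_union]
      constructor
      · rintro ⟨⟨-, h2⟩, h3⟩
        exact ⟨h3, fun h4 => h2 h4.1⟩
      · rintro ⟨h1, h2⟩
        exact ⟨⟨Or.inl h1, fun h3 => h2 ⟨h3, h1⟩⟩, h1⟩
    have s2 : ((gr M ∪ E₂) \ I) ∩ E₂ = E₂ \ I := by
      ext e
      simp only [mem_inter, mem_sdiff, mem_union]
      constructor
      · rintro ⟨⟨-, h2⟩, h3⟩
        exact ⟨h3, h2⟩
      · rintro ⟨h1, h2⟩
        exact ⟨⟨Or.inr h1, h2⟩, h1⟩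
    rw [toNat_eRk_disjointSum_comapOn M c E₂ h, s1, s2]
  refine (Finset.sum_congr rfl fun I hI => ?_).trans_le (key.trans_eq (Finset.sum_congr rfl fun I hI => ?_))
  · rw [hrk I hI, hcork I hI]
  · rw [hcork I hI]

/-- C-025 AT EVERY `(p, q)` ON EVERY TRUNCATION OF «M ⊕ PARALLEL CLASSES ⊕ FREE POINTS», for every finite `M`
satisfying PER-LAYER DOMINANCE. -/
theorem rls_truncate_disjointSum_parallelClasses_freeOn_of_pld (M : Matroid α) [M.Finite]
    (hPLD : ∀ lo hi δ Θ : ℕ, Θ ≤ lo + hi + δ → (lo = 0 ∨ lo + hi + δ ≤ Θ) →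
      (∑ I ∈ (gr M).powerset, (if lo ≤ (M.eRk (I : Set α)).toNat ∧ (M.eRk (I : Set α)).toNat ≤ hi ∧
          Θ ≤ (M.eRk ((gr M \ I : Finset α) : Set α)).toNat + (M.eRk (I : Set α)).toNat then
          ((M.eRk ((gr M \ I : Finset α) : Set α)).toNat).choose δ else 0)) ≤
        ∑ I ∈ (gr M).powerset, (if lo + δ ≤ (M.eRk ((gr M \ I : Finset α) : Set α)).toNat ∧
          (M.eRk ((gr M \ I : Finset α) : Set α)).toNat ≤ hi + δ then
          ((M.eRk ((gr M \ I : Finset α) : Set α)).toNat).choose δ else 0))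
    (c : α → β) (E₂ : Finset α) (h : Disjoint M.E (E₂ : Set α)) (E₃ : Finset α)
    (h₃ : Disjoint (M.disjointSum ((Matroid.freeOn (Set.univ : Set β)).comapOn (E₂ : Set α) c) h).E (E₃ : Set α))
    (r p q : ℕ) :
    haveI := disjointSum_comapOn_finite M c E₂ h
    haveI := PLDBridge.disjointSum_freeOn_finite _ E₃ h₃
    ThmN.RLS (PercRepro.Matroid.truncate
      ((M.disjointSum ((Matroid.freeOn (Set.univ : Set β)).comapOn (E₂ : Set α) c) h).disjointSum
        (Matroid.freeOn (E₃ : Set α)) h₃) r) p q := by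
  haveI := disjointSum_comapOn_finite M c E₂ h
  exact PLDBridge.rls_disjointSum_freeOn_of_pld _ E₃ h₃ r p q (pld_disjointSum_parallelClasses M hPLD c E₂ h)

end PLDClosure

end PercRepro
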